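import Mathlib
import Literature.NumberTheory.DiophantineGeometry.NoncriticalBelyiDescent
import Literature.NumberTheory.DiophantineGeometry.NoncriticalBelyiRational

/-!
# Noncritical Belyi maps on `ℙ¹`, step III: a Belyi map over `ℚ` protecting a `p`-adically large
# rational point

S. Mochizuki, *Noncritical Belyi maps* [cite: MochizukiNCBelyi2004], proof of Theorem 2.5 (pp. 5–7)
in genus `0` ("by applying Lemma 2.4, one reduces to the case `X = ℙ¹_ℚ`, `S ⊆ ℙ¹(ℚ)`, `T = {β}` …
Thus, Theorem 2.5 follows from Lemma 2.2"); equivalently Scherr–Zieve [cite: ScherrZieve2014], proof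
of Thm. 1 for `C = ℙ¹` (`φ := φ₃ ∘ φ₂`).  We compose the two steps already in the tree:

* `NoncriticalBelyi.descent` (step I, `NoncriticalBelyiDescent.lean`): `g ∈ ℤ[x]` with `g(S) ⊂ ℤ`,
  integral critical values, `|g(b)|_p > 1`, `g'(b) ≠ 0`;
* `NoncriticalBelyi.rational_step` (step II, `NoncriticalBelyiRational.lean`, Scherr–Zieve Prop. 8)
  applied to `B := w·(g(S) ∪ {critical values})` and `β := w·g(b)`, `w` the denominator of `g(b)`
  (an integer scaling making everything integral; `β ∉ B` because `g(b) ∉ ℤ`).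

Result `NoncriticalBelyi.core`: for a prime `p`, a finite set `S` of algebraic integers of degrees
`< p`, and `b ∈ ℚ` with `|b|_p > 1`, there are coprime `P, Q ∈ ℚ[x]` of the same positive degree and
the same leading coefficient (so `β₀ := P/Q` has `β₀(∞) = 1`) such that every complex zero of the
Wronskian `P'Q − PQ'` is a zero of `P·Q` (the branch locus of `β₀ : ℙ¹ → ℙ¹` lies in `{0, 1, ∞}`),
`β₀(S) ⊆ {0, ∞}`, and `β₀(b) ∉ {0, 1, ∞}` with `β₀` unramified at `b`.  The Möbius change of
variable that turns "protecting `b`" into "protecting `∞`" for an arbitrary finite set of algebraic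
numbers is `NoncriticalBelyiGenusZero.lean`.  No definitions, no named facts.
-/

namespace Literature.NumberTheory.DiophantineGeometry

open Polynomial Finset

namespace NoncriticalBelyi

/-- Wronskian of a composition: `W(P ∘ G, Q ∘ G) = G' · (W(P, Q) ∘ G)`. [folklore] -/
private theorem wronskian_comp {R : Type*} [CommRing R] (P Q G : R[X]) :
    derivative (P.comp G) * Q.comp G - P.comp G * derivative (Q.comp G) =
      derivative G * (derivative P * Q - P * derivative Q).comp G := by
  rw [derivative_comp, derivative_comp, sub_comp, mul_comp, mul_comp]; ring

/-- A rational number of `p`-adic norm `> 1` is not an integer. [folklore] -/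
private theorem ne_intCast_of_one_lt_padicNorm {p : ℕ} [Fact p.Prime] {b : ℚ}
    (hb : 1 < padicNorm p b) (z : ℤ) : b ≠ z := by
  rintro rfl
  exact absurd (padicNorm.of_int (p := p) z) (not_le.2 hb)

/-- **[NCBelyi] Thm. 2.5 in genus `0`, protecting a `p`-adically large rational point** (steps I +
II composed; cf. Scherr–Zieve, proof of Thm. 1, `φ₃ ∘ φ₂`).  For a prime `p`, a finite set `S ⊂ ℂ`
of algebraic integers all of degree `< p` over `ℚ`, and `b ∈ ℚ` with `|b|_p > 1`, there are coprime
`P, Q ∈ ℚ[x]` with `deg P = deg Q = d ≥ 1` and equal leading coefficients such that: every complex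
zero of `P'Q − PQ'` is a zero of `P` or of `Q`; every `s ∈ S` is a zero of `P` or of `Q`; and
`P(b), Q(b) ≠ 0`, `P(b) ≠ Q(b)`, `(P'Q − PQ')(b) ≠ 0`.
[cite: MochizukiNCBelyi2004, Thm 2.5 (proof, pp. 6–7)] -/
theorem core (p : ℕ) [Fact p.Prime] (S : Finset ℂ) (hint : ∀ s ∈ S, IsIntegral ℤ s)
    (hdeg : ∀ s ∈ S, (minpoly ℚ s).natDegree < p) (b : ℚ) (hb : 1 < padicNorm p b) :
    ∃ (P Q : ℚ[X]) (d : ℕ), 0 < d ∧ P.natDegree = d ∧ Q.natDegree = d ∧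
      P.leadingCoeff = Q.leadingCoeff ∧ IsCoprime P Q ∧
      (∀ z : ℂ, aeval z (derivative P * Q - P * derivative Q) = 0 → aeval z P = 0 ∨ aeval z Q = 0) ∧
      (∀ s ∈ S, aeval s P = 0 ∨ aeval s Q = 0) ∧
      P.eval b ≠ 0 ∧ Q.eval b ≠ 0 ∧ P.eval b ≠ Q.eval b ∧
      (derivative P * Q - P * derivative Q).eval b ≠ 0 := by
  classical
  -- step I
  obtain ⟨g, hgdeg, hgS, hgcrit, hgb⟩ := descent p S hint hdeg
  obtain ⟨hb₁, hg'b⟩ := hgb b hb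
  set gQ : ℚ[X] := g.map (Int.castRingHom ℚ) with hgQ
  have hgQdeg : gQ.natDegree = g.natDegree :=
    natDegree_map_eq_of_injective (Int.castRingHom ℚ).injective_int _
  have haevalQ : ∀ x : ℚ, aeval x g = gQ.eval x := by
    intro x; rw [hgQ, eval_map, ← algebraMap_int_eq, ← aeval_def]
  have haevalC : ∀ z : ℂ, aeval z g = aeval z gQ := by
    intro z; rw [hgQ, ← algebraMap_int_eq, aeval_map_algebraMap]
  have haevalC' : ∀ z : ℂ, aeval z (derivative g) = aeval z (derivative gQ) := by
    intro z; rw [hgQ, derivative_map, ← algebraMap_int_eq, aeval_map_algebraMap]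
  -- the non-integral rational `b₁ = g(b)`, its denominator `w` and numerator `β₃`
  set b₁ : ℚ := aeval b g with hb₁def
  set w : ℕ := b₁.den with hw
  have hw0 : (w : ℚ) ≠ 0 := by rw [hw]; exact_mod_cast b₁.den_nz
  set β₃ : ℤ := b₁.num with hβ₃
  have hwb₁ : (w : ℚ) * b₁ = β₃ := by
    rw [hw, hβ₃, mul_comm]; exact Rat.mul_den_eq_num b₁
  -- the finite set of integer values of `g` on `S` and on its critical points
  have hg'C : (derivative g).map (algebraMap ℤ ℂ) ≠ 0 :=
    (Polynomial.map_ne_zero_iff (algebraMap ℤ ℂ).injective_int).2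
      (derivative_ne_zero.2 hgdeg.ne')
  set CP : Finset ℂ := ((derivative g).map (algebraMap ℤ ℂ)).roots.toFinset with hCP
  have hCPmem : ∀ z : ℂ, aeval z (derivative g) = 0 → z ∈ CP := by
    intro z hz
    rw [hCP, Multiset.mem_toFinset, mem_roots hg'C, IsRoot.def, eval_map_algebraMap]
    exact hz
  have hinj : Set.InjOn (Int.cast : ℤ → ℂ)
      ((Int.cast : ℤ → ℂ) ⁻¹' ↑((S ∪ CP).image fun u => aeval u g)) :=
    Int.cast_injective.injOn
  set T : Finset ℤ := ((S ∪ CP).image fun u => aeval u g).preimage (Int.cast : ℤ → ℂ) hinj with hT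
  have hTS : ∀ s ∈ S, ∃ r ∈ T, aeval s g = (r : ℂ) := by
    intro s hs
    obtain ⟨r, hr⟩ := hgS s hs
    refine ⟨r, ?_, hr⟩
    rw [hT, mem_preimage, ← hr]
    exact mem_image.2 ⟨s, mem_union.2 (Or.inl hs), rfl⟩
  have hTcrit : ∀ z : ℂ, aeval z (derivative g) = 0 → ∃ r ∈ T, aeval z g = (r : ℂ) := by
    intro z hz
    obtain ⟨r, hr⟩ := hgcrit z hz
    refine ⟨r, ?_, hr⟩
    rw [hT, mem_preimage, ← hr]
    exact mem_image.2 ⟨z, mem_union.2 (Or.inr (hCPmem z hz)), rfl⟩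
  -- step II on `B₃ := w·T`, `β₃ := w·b₁ ∉ B₃`
  set B₃ : Finset ℤ := T.image fun r => (w : ℤ) * r with hB₃
  have hβB : β₃ ∉ B₃ := by
    intro h
    obtain ⟨r, _, hr⟩ := mem_image.1 h
    apply ne_intCast_of_one_lt_padicNorm hb₁ r
    have h1 : (w : ℚ) * b₁ = (w : ℚ) * r := by rw [hwb₁, ← hr]; push_cast; ring
    exact mul_left_cancel₀ hw0 h1
  obtain ⟨P₃, Q₃, hP₃m, hQ₃m, hcop, hP₃deg, hPQdeg, hBval, hcrit₃, hPβ, hQβ, hPQβ, hWβ⟩ :=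
    rational_step B₃ β₃ hβB
  -- the composite `P₀ = P₃ ∘ (w·g)`, `Q₀ = Q₃ ∘ (w·g)`
  set Gw : ℚ[X] := C (w : ℚ) * gQ with hGw
  have hGwdeg : Gw.natDegree = g.natDegree := by rw [hGw, natDegree_C_mul hw0, hgQdeg]
  have hGwdeg0 : Gw.natDegree ≠ 0 := by rw [hGwdeg]; exact hgdeg.ne'
  have hGw_of_T : ∀ u : ℂ, ∀ r ∈ T, aeval u g = (r : ℂ) →
      aeval u Gw = algebraMap ℚ ℂ (((w : ℤ) * r : ℤ) : ℚ) := by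
    intro u r _ hur
    rw [hGw, map_mul, aeval_C, ← haevalC, hur]
    simp
  have hval_of_T : ∀ u : ℂ, ∀ r ∈ T, aeval u g = (r : ℂ) →
      aeval u (P₃.comp Gw) = 0 ∨ aeval u (Q₃.comp Gw) = 0 := by
    intro u r hr hur
    have hb3 : (w : ℤ) * r ∈ B₃ := mem_image.2 ⟨r, hr, rfl⟩
    rw [aeval_comp, aeval_comp, hGw_of_T u r hr hur, aeval_algebraMap_apply_eq_algebraMap_eval,
      aeval_algebraMap_apply_eq_algebraMap_eval]
    rcases hBval _ hb3 with h | h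
    · left; rw [h, map_zero]
    · right; rw [h, map_zero]
  have hGwb : Gw.eval b = β₃ := by
    rw [hGw, eval_mul, eval_C, ← haevalQ, ← hb₁def, hwb₁]
  refine ⟨P₃.comp Gw, Q₃.comp Gw, P₃.natDegree * g.natDegree, Nat.mul_pos hP₃deg hgdeg,
    by rw [natDegree_comp, hGwdeg], by rw [natDegree_comp, ← hPQdeg, hGwdeg], ?_, ?_, ?_, ?_, ?_,
    ?_, ?_, ?_⟩
  · rw [leadingCoeff_comp hGwdeg0, leadingCoeff_comp hGwdeg0, hP₃m.leadingCoeff,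
      hQ₃m.leadingCoeff, hPQdeg]
  · exact hcop.map (Polynomial.compRingHom Gw)
  · -- branch values of the finite critical points of `β₀`
    intro z hz
    rw [wronskian_comp, map_mul, mul_eq_zero] at hz
    rcases hz with hz | hz
    · -- `z` is a critical point of `g`
      rw [hGw, derivative_mul, derivative_C, zero_mul, zero_add, map_mul, aeval_C, mul_eq_zero,
        map_eq_zero_iff _ (algebraMap ℚ ℂ).injective] at hz
      rcases hz with hz | hz
      · exact absurd hz hw0
      · rw [← haevalC'] at hz
        obtain ⟨r, hr, hzr⟩ := hTcrit z hz
        exact hval_of_T z r hr hzr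
    · -- `Gw(z)` is a critical point of `P₃/Q₃`
      rw [aeval_comp] at hz
      rw [aeval_comp, aeval_comp]
      exact hcrit₃ _ hz
  · intro s hs
    obtain ⟨r, hr, hsr⟩ := hTS s hs
    exact hval_of_T s r hr hsr
  · rwa [eval_comp, hGwb]
  · rwa [eval_comp, hGwb]
  · rwa [eval_comp, eval_comp, hGwb]
  · rw [wronskian_comp, eval_mul, eval_comp, hGwb, hGw, derivative_mul, derivative_C, zero_mul,
      zero_add, eval_mul, eval_C]
    refine mul_ne_zero (mul_ne_zero hw0 ?_) hWβ
    rwa [hgQ, derivative_map, eval_map, ← algebraMap_int_eq, ← aeval_def]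

end NoncriticalBelyi

end Literature.NumberTheory.DiophantineGeometry
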